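/-
Copyright (c) 2026. Released under Apache 2.0 license.
-/
import Summits.RiemannHypothesis.RiemannHypothesis.Theorems.MotivicDoorSemilocalArchMomentsSharp
import Summits.RiemannHypothesis.RiemannHypothesis.Theorems.MotivicDoorSemilocalQuinticWitness
import Literature.NumberTheory.LFunctions.WeilArchDensityPanels
import Literature.Analysis.ValidatedNumerics.ExpSumEnclosure
import HarnessLib

/-!
# Motivic door, semi-local ladder — EXACT evaluation of the archimedean energy of a polynomial increment

Cell `rh-explicit` (seat cc-s2-2), workstream CC-M2: the cell-free ("exact-evaluation") format for NEGATIVE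
certificates of the `{∞,2}` semi-local Weil form.  For a Markov witness whose increment is a polynomial on the window,
`D(t) = Σ_i d_i t^{i+1}` on `(0, L]` (`L = 2b`; `d_i ∈ ℚ`), the archimedean energy `∫_{(0,L]} ρ(t) D(t) dt`
(`ρ = weilArchDensity = e^{t/2}/(2 sinh t)`) is bounded ABOVE by a FINITE EXPONENTIAL SUM with rational data,

  `∫_{(0,L]} ρ D ≤ esum (archTerms d 0 M L)`      (`setIntegral_weilArchDensity_mul_polyT_le`),

obtained moment by moment: for `d_i ≥ 0` the sharp UPPER moment bound, for `d_i < 0` the sharp LOWER one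
(`MotivicDoorSemilocalArchMomentsSharp`: `Σ_{m<M} I(2m+½) + ½I_k(2M+½) + ½I_{k+1}(2M+½) [+ ⅙I_{k+2}(2M+½)]`), each
`I_k(a) = ∫_0^L t^k e^{−at} dt = k!/a^{k+1} − e^{−aL} P_k(a,L)` (`integral_pow_mul_exp_neg_mul`) being two terms of
the group ring `ℚ[e^ℚ]` (`Iterms`).  The kernel then certifies `esum (…) ≤ bn/bd` with
`Literature/Analysis/ValidatedNumerics/ExpSumEnclosure.lean` (`checkUB`, `decide +kernel`) in the rung files.  The
enclosure width is `Σ_i |d_i| (i+2)!/(6 (2M+½)^{i+3})` — `O(M^{-3})` and better — so that `M ≈ 80…120` exponential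
terms certify the archimedean energy of the degree-11…15 witnesses to `10⁻⁸` of its size, versus the `5·10⁻³` kernel
loss of the zeroth-order cell sums of the earlier rungs (`MotivicDoorSemilocalUndecicBound`), which is what stopped
them at `b = 0.57`.

Contents (all PROVED, sorry-free): `qE`/`qE_val` (a rational term), `esum_append`, `incGammaPolyQ` (+ cast),
`Iterms`/`esum_Iterms`, `sumTerms`/`esum_sumTerms`, `upperTerms`/`lowerTerms` (+ `esum_…`), `momTerms`,
`integrableOn_pow_succ_mul_weilArchDensity`, `mul_setIntegral_le_esum_momTerms`, `polyT`, `archTerms`,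
`setIntegral_weilArchDensity_mul_polyT_le`.  Honest framing: bookkeeping for a quantitative theorem about
Connes' semi-local Weil functional at `S = {∞,2}`; nothing here bears on RH.
-/

set_option linter.dupNamespace false

noncomputable section

open Real Set MeasureTheory Finset intervalIntegral
open scoped BigOperators Topology
open Literature.NumberTheory.LFunctions
open Literature.Analysis.ValidatedNumerics.ExpSum

namespace Summit.RiemannHypothesis.RiemannHypothesis.Theorems.MotivicDoor.SemilocalArchExact

open SemilocalArchMoments

/-! ## Terms of the group ring `ℚ[e^ℚ]` -/

/-- The term `c · e^{q}` with rational `c, q`. -/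
def qE (c q : ℚ) : ETerm := ⟨c.num, c.den, q.num, q.den⟩

/-- Its value. -/
theorem qE_val (c q : ℚ) : (qE c q).val = (c : ℝ) * Real.exp (q : ℝ) := by
  simp only [qE, ETerm.val]
  rw [Rat.cast_def c, Rat.cast_def q]

/-- `esum` is additive over concatenation. -/
theorem esum_append : ∀ (A B : List ETerm), esum (A ++ B) = esum A + esum B
  | [], B => by simp [esum]
  | t :: A, B => by rw [List.cons_append, esum, esum, esum_append A B, add_assoc]

/-- `esum [t] = t.val`. -/
theorem esum_singleton (t : ETerm) : esum [t] = t.val := by simp [esum]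

/-! ## The incomplete gamma polynomial over `ℚ` -/

/-- `P_k(a, L) = Σ_{j ≤ k} k! L^j / (j! a^{k+1−j})` as a rational number. -/
def incGammaPolyQ (k : ℕ) (a L : ℚ) : ℚ :=
  ∑ j ∈ Finset.range (k + 1), (k.factorial : ℚ) * L ^ j / ((j.factorial : ℚ) * a ^ (k + 1 - j))

/-- Cast to `ℝ`. -/
theorem incGammaPolyQ_cast (k : ℕ) (a L : ℚ) :
    ((incGammaPolyQ k a L : ℚ) : ℝ) = incGammaPoly k (a : ℝ) (L : ℝ) := by
  unfold incGammaPolyQ incGammaPoly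
  push_cast
  rfl

/-- The two terms of `c · I_k(a, L)`, `I_k(a,L) = ∫_0^L t^k e^{−at} dt = k!/a^{k+1} − e^{−aL} P_k(a,L)`. -/
def Iterms (c : ℚ) (k : ℕ) (a L : ℚ) : List ETerm :=
  [qE (c * k.factorial / a ^ (k + 1)) 0, qE (-(c * incGammaPolyQ k a L)) (-(a * L))]

/-- `esum (Iterms c k a L) = c · ∫_0^L t^k e^{−at} dt` (`a ≠ 0`). -/
theorem esum_Iterms (c : ℚ) (k : ℕ) {a : ℚ} (ha : a ≠ 0) (L : ℚ) :
    esum (Iterms c k a L) = (c : ℝ) * ∫ t in (0 : ℝ)..L, t ^ k * Real.exp (-((a : ℝ) * t)) := by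
  have ha' : (a : ℝ) ≠ 0 := by exact_mod_cast ha
  rw [integral_pow_mul_exp_neg_mul k ha' L, Iterms, esum, esum, esum, qE_val, qE_val, ← incGammaPolyQ_cast]
  push_cast
  rw [Real.exp_zero]
  ring

/-! ## The finite exponential sums of the sharp moment bounds -/

/-- `a_m = 2m + ½`. -/
def lamQ (m : ℕ) : ℚ := 2 * m + 1 / 2

/-- `a_m ≠ 0`. -/
theorem lamQ_ne_zero (m : ℕ) : lamQ m ≠ 0 := by unfold lamQ; positivity

/-- Cast of `a_m`. -/
theorem lamQ_cast (m : ℕ) : ((lamQ m : ℚ) : ℝ) = 2 * (m : ℝ) + 1 / 2 := by unfold lamQ; push_cast; ring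

/-- The terms of `c · Σ_{m<M} I_k(a_m, L)`. -/
def sumTerms (c : ℚ) (k : ℕ) : ℕ → ℚ → List ETerm
  | 0, _ => []
  | M + 1, L => sumTerms c k M L ++ Iterms c k (lamQ M) L

/-- Its value. -/
theorem esum_sumTerms (c : ℚ) (k : ℕ) (L : ℚ) : ∀ M : ℕ,
    esum (sumTerms c k M L) =
      (c : ℝ) * ∑ m ∈ Finset.range M, ∫ t in (0 : ℝ)..L, t ^ k * Real.exp (-((2 * (m : ℝ) + 1 / 2) * t))
  | 0 => by simp [sumTerms, esum]
  | M + 1 => by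
      rw [sumTerms, esum_append, esum_sumTerms c k L M, esum_Iterms c k (lamQ_ne_zero M), lamQ_cast,
        Finset.sum_range_succ, mul_add]

/-- The terms of `c ·` (sharp UPPER bound of the moment `∫_{(0,L]} t^{k+1} ρ`). -/
def upperTerms (c : ℚ) (k M : ℕ) (L : ℚ) : List ETerm :=
  sumTerms c (k + 1) M L ++ Iterms (c / 2) k (lamQ M) L ++ Iterms (c / 2) (k + 1) (lamQ M) L ++
    Iterms (c / 6) (k + 2) (lamQ M) L

/-- The terms of `c ·` (sharp LOWER bound of the moment `∫_{(0,L]} t^{k+1} ρ`). -/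
def lowerTerms (c : ℚ) (k M : ℕ) (L : ℚ) : List ETerm :=
  sumTerms c (k + 1) M L ++ Iterms (c / 2) k (lamQ M) L ++ Iterms (c / 2) (k + 1) (lamQ M) L

/-- Value of `upperTerms`. -/
theorem esum_upperTerms (c : ℚ) (k M : ℕ) (L : ℚ) :
    esum (upperTerms c k M L) = (c : ℝ) *
      ((∑ m ∈ Finset.range M, ∫ t in (0 : ℝ)..L, t ^ (k + 1) * Real.exp (-((2 * (m : ℝ) + 1 / 2) * t))) +
        1 / 2 * (∫ t in (0 : ℝ)..L, t ^ k * Real.exp (-((2 * (M : ℝ) + 1 / 2) * t))) +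
        1 / 2 * (∫ t in (0 : ℝ)..L, t ^ (k + 1) * Real.exp (-((2 * (M : ℝ) + 1 / 2) * t))) +
        1 / 6 * (∫ t in (0 : ℝ)..L, t ^ (k + 2) * Real.exp (-((2 * (M : ℝ) + 1 / 2) * t)))) := by
  rw [upperTerms, esum_append, esum_append, esum_append, esum_sumTerms,
    esum_Iterms _ _ (lamQ_ne_zero M), esum_Iterms _ _ (lamQ_ne_zero M), esum_Iterms _ _ (lamQ_ne_zero M), lamQ_cast]
  push_cast
  ring

/-- Value of `lowerTerms`. -/
theorem esum_lowerTerms (c : ℚ) (k M : ℕ) (L : ℚ) :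
    esum (lowerTerms c k M L) = (c : ℝ) *
      ((∑ m ∈ Finset.range M, ∫ t in (0 : ℝ)..L, t ^ (k + 1) * Real.exp (-((2 * (m : ℝ) + 1 / 2) * t))) +
        1 / 2 * (∫ t in (0 : ℝ)..L, t ^ k * Real.exp (-((2 * (M : ℝ) + 1 / 2) * t))) +
        1 / 2 * (∫ t in (0 : ℝ)..L, t ^ (k + 1) * Real.exp (-((2 * (M : ℝ) + 1 / 2) * t)))) := by
  rw [lowerTerms, esum_append, esum_append, esum_sumTerms,
    esum_Iterms _ _ (lamQ_ne_zero M), esum_Iterms _ _ (lamQ_ne_zero M), lamQ_cast]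
  push_cast
  ring

/-- The terms bounding `c · ∫_{(0,L]} t^{k+1} ρ` from above: upper moment bound if `c ≥ 0`, lower if `c < 0`. -/
def momTerms (c : ℚ) (k M : ℕ) (L : ℚ) : List ETerm :=
  if 0 ≤ c then upperTerms c k M L else lowerTerms c k M L

/-! ## Integrability of `t^{k+1} ρ` on `(0, L]` -/

/-- `t ↦ t^{k+1} ρ(t)` is integrable on `(0, L]` (`t^{k+1}ρ = t^k · g`, `g = tρ ≤ t + ½`). -/
theorem integrableOn_pow_succ_mul_weilArchDensity (k : ℕ) {L : ℝ} (hL : 0 ≤ L) :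
    IntegrableOn (fun t : ℝ ↦ t ^ (k + 1) * weilArchDensity t) (Ioc 0 L) := by
  have h := intervalIntegrable_weilArchDensityG_mul le_rfl hL (q := fun t : ℝ ↦ t ^ k) (by fun_prop)
  rw [intervalIntegrable_iff_integrableOn_Ioc_of_le hL] at h
  refine h.congr_fun (fun t ht ↦ ?_) measurableSet_Ioc
  show weilArchDensityG t * t ^ k = t ^ (k + 1) * weilArchDensity t
  rw [weilArchDensityG_of_ne (ne_of_gt ht.1), pow_succ]
  ring

/-- **Sign-split moment bound**: `c · ∫_{(0,L]} t^{k+1} ρ ≤ esum (momTerms c k M L)` for rational `L > 0`. -/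
theorem mul_setIntegral_le_esum_momTerms (c : ℚ) (k M : ℕ) {L : ℚ} (hL : 0 < L) :
    (c : ℝ) * ∫ t in Ioc 0 (L : ℝ), t ^ (k + 1) * weilArchDensity t ≤ esum (momTerms c k M L) := by
  have hL' : (0 : ℝ) < L := by exact_mod_cast hL
  have hint := integrableOn_pow_succ_mul_weilArchDensity k hL'.le
  unfold momTerms
  split_ifs with hc
  · rw [esum_upperTerms]
    exact mul_le_mul_of_nonneg_left (setIntegral_pow_mul_weilArchDensity_le_sharp k hL' M hint)
      (by exact_mod_cast hc)
  · rw [esum_lowerTerms]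
    have hc' : (c : ℝ) ≤ 0 := by exact_mod_cast (le_of_lt (not_le.1 hc))
    exact mul_le_mul_of_nonpos_left (setIntegral_pow_mul_weilArchDensity_ge_sharp k hL' M hint) hc'

/-! ## Polynomial increments -/

/-- `polyT [d₀, d₁, …] k t = Σ_i d_i t^{k+1+i}`: a polynomial increment without constant term. -/
def polyT : List ℚ → ℕ → ℝ → ℝ
  | [], _, _ => 0
  | c :: cs, k, t => (c : ℝ) * t ^ (k + 1) + polyT cs (k + 1) t

/-- `polyT l k` is continuous. -/
theorem continuous_polyT : ∀ (l : List ℚ) (k : ℕ), Continuous (polyT l k)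
  | [], k => by simpa [polyT] using continuous_const
  | c :: cs, k => by
      have ih := continuous_polyT cs (k + 1)
      have : polyT (c :: cs) k = fun t ↦ (c : ℝ) * t ^ (k + 1) + polyT cs (k + 1) t := funext fun t ↦ rfl
      rw [this]; fun_prop

/-- `polyT` with the shift `k` is `t^k ·` the unshifted one. -/
theorem polyT_succ_eq : ∀ (l : List ℚ) (k : ℕ) (t : ℝ), polyT l (k + 1) t = t * polyT l k t
  | [], k, t => by simp [polyT]
  | c :: cs, k, t => by rw [polyT, polyT, polyT_succ_eq cs (k + 1) t, pow_succ]; ring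

/-- `ρ · polyT` is integrable on `(0, L]`. -/
theorem integrableOn_weilArchDensity_mul_polyT : ∀ (l : List ℚ) (k : ℕ) {L : ℝ}, 0 ≤ L →
    IntegrableOn (fun t : ℝ ↦ weilArchDensity t * polyT l k t) (Ioc 0 L)
  | [], k, L, _ => by simp [polyT]
  | c :: cs, k, L, hL => by
      have h1 := (integrableOn_pow_succ_mul_weilArchDensity k hL).const_mul (c : ℝ)
      have h2 := integrableOn_weilArchDensity_mul_polyT cs (k + 1) hL
      refine IntegrableOn.congr_fun (h1.add h2) (fun t _ ↦ ?_) measurableSet_Ioc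
      simp only [Pi.add_apply, polyT]
      ring

/-- The exponential-sum terms bounding `∫_{(0,L]} ρ · polyT l k` from above. -/
def archTerms : List ℚ → ℕ → ℕ → ℚ → List ETerm
  | [], _, _, _ => []
  | c :: cs, k, M, L => momTerms c k M L ++ archTerms cs (k + 1) M L

/-- **The archimedean energy of a polynomial increment is bounded by a finite exponential sum**:
`∫_{(0,L]} ρ(t) · polyT l k t dt ≤ esum (archTerms l k M L)` (rational `L > 0`, any `M`). -/
theorem setIntegral_weilArchDensity_mul_polyT_le : ∀ (l : List ℚ) (k M : ℕ) {L : ℚ}, 0 < L →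
    ∫ t in Ioc 0 (L : ℝ), weilArchDensity t * polyT l k t ≤ esum (archTerms l k M L)
  | [], k, M, L, _ => by simp [polyT, archTerms, esum]
  | c :: cs, k, M, L, hL => by
      have hL' : (0 : ℝ) ≤ L := by exact_mod_cast hL.le
      have h1 := (integrableOn_pow_succ_mul_weilArchDensity k hL').const_mul (c : ℝ)
      have h2 := integrableOn_weilArchDensity_mul_polyT cs (k + 1) hL'
      have hsplit : ∫ t in Ioc 0 (L : ℝ), weilArchDensity t * polyT (c :: cs) k t
          = (c : ℝ) * (∫ t in Ioc 0 (L : ℝ), t ^ (k + 1) * weilArchDensity t)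
            + ∫ t in Ioc 0 (L : ℝ), weilArchDensity t * polyT cs (k + 1) t := by
        rw [← MeasureTheory.integral_const_mul, ← integral_add h1 h2]
        refine setIntegral_congr_fun measurableSet_Ioc fun t _ ↦ ?_
        simp only [polyT]
        ring
      rw [hsplit, archTerms, esum_append]
      exact add_le_add (mul_setIntegral_le_esum_momTerms c k M hL)
        (setIntegral_weilArchDensity_mul_polyT_le cs (k + 1) M hL)

/-! ## Block-wise kernel check

One `checkUB` over all `≈ 3000` terms of `archTerms` exceeds the kernel's recursion budget; one per coefficient
(`≈ 130` terms) does not. -/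

/-- Block-wise kernel check of an upper bound `Σ us` for `esum (archTerms l k M L)`: one
`ExpSum.checkUB` (scale `S`, `K` Taylor terms, `kh` halvings) per coefficient, against the claimed integer
bound `u` of that block. -/
def archCheck (S K kh : ℕ) : List ℚ → ℕ → ℕ → ℚ → List ℤ → Bool
  | [], _, _, _, [] => true
  | c :: cs, k, M, L, u :: us => checkUB S K kh (momTerms c k M L) u 1 && archCheck S K kh cs (k + 1) M L us
  | [], _, _, _, _ :: _ => false
  | _ :: _, _, _, _, [] => false

/-- Soundness of `archCheck`: `esum (archTerms l k M L) ≤ Σ us`. -/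
theorem esum_archTerms_le_of_archCheck {S K kh : ℕ} (hS : 0 < S) :
    ∀ (l : List ℚ) (k M : ℕ) (L : ℚ) (us : List ℤ), archCheck S K kh l k M L us = true →
      esum (archTerms l k M L) ≤ ((us.sum : ℤ) : ℝ)
  | [], _, _, _, [], _ => by simp [archTerms, esum]
  | c :: cs, k, M, L, u :: us, h => by
      simp only [archCheck, Bool.and_eq_true] at h
      rw [archTerms, esum_append, List.sum_cons, Int.cast_add]
      have h1 := esum_le_of_checkUB hS Nat.one_pos h.1
      have h2 := esum_archTerms_le_of_archCheck hS cs (k + 1) M L us h.2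
      simp only [Nat.cast_one, div_one] at h1
      exact add_le_add h1 h2
  | [], _, _, _, _ :: _, h => by simp [archCheck] at h
  | _ :: _, _, _, _, [], h => by simp [archCheck] at h

/-- **Kernel-certified bound of the archimedean energy of a polynomial increment**:
`archCheck S K kh l k M L us = true → ∫_{(0,L]} ρ · polyT l k ≤ Σ us`. -/
theorem setIntegral_weilArchDensity_mul_polyT_le_of_archCheck {S K kh : ℕ} (hS : 0 < S) (l : List ℚ)
    (k M : ℕ) {L : ℚ} (hL : 0 < L) {us : List ℤ} (h : archCheck S K kh l k M L us = true) :
    ∫ t in Ioc 0 (L : ℝ), weilArchDensity t * polyT l k t ≤ ((us.sum : ℤ) : ℝ) :=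
  (setIntegral_weilArchDensity_mul_polyT_le l k M hL).trans (esum_archTerms_le_of_archCheck hS l k M L us h)

/-- The unshifted case, with `SemilocalQuintic.polyR`: `polyT l 0 t = t · polyR l t`. -/
theorem polyT_zero_eq_mul_polyR : ∀ (l : List ℚ) (t : ℝ), polyT l 0 t = t * SemilocalQuintic.polyR l t
  | [], t => by simp [polyT, SemilocalQuintic.polyR]
  | c :: cs, t => by
      rw [polyT, SemilocalQuintic.polyR, polyT_succ_eq, polyT_zero_eq_mul_polyR cs t]
      ring

end Summit.RiemannHypothesis.RiemannHypothesis.Theorems.MotivicDoor.SemilocalArchExact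

end
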